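import Summits.ABC.IUTFork.Cor312TeamAAssembly
import Summits.ABC.IUTFork.Cor312StepXReal
import Summits.ABC.IUTFork.Cor312StepXIabcReal
import Summits.ABC.IUTFork.Cor312StepXIdeReal
import HarnessLib

/-!
# [IUTchIII] Cor. 3.12 — TEAM A full-chain census: all twenty nodes composed, the hypothesis list explicit

Record-only file (D-0012) of the abc-iut cell (Cor. 3.12 STRATEGY TEAM A «direct III§3», D-0067, seat
abc-iut-c312-9 = A1, rows A-4/A-5 of `HOME/plan/C312-TEAMS.md`); TAKES NO SIDE; proof-only. With A-1
(`Cor312StepXReal`, c312-10), A-2 (`Cor312StepXIabcReal`, c312-10), A-3 (`Cor312StepXIdeReal`, c312-4) and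
A-4 (`Cor312StepXIfChain`/`Cor312StepContents`/`Cor312TeamAAssembly`, this seat) all landed, this file
composes the TWENTY `Step.Holds` lemmas into the one `Chain` instance and the end-to-end Statement theorem:

* `teamA_chain` — `Cor312Proof.Chain L O` from the named inputs. The HYPOTHESIS LIST is the team's honest
  census for the 13:00Z adjudication (plan/ADJUDICATION-SPEC.md §2 (U)): per node, what is PROVED outright
  over the frozen definitions (Step (x)'s `TensorMultZ`, `KummerDetach`, the coarse-space engine;
  (xi-b)/(xi-c)'s full-poly-iso and hull facts; (xi-e) outright for agreeing readings; (xi-h) via the landed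
  `nthPower_not_formal`) and what is CONSUMED as a named input: the loci-side real discharges `hIndAdm`/
  `hIndVol`/`hMono`/`hKumA` (Team B rows B-2/B-4 for the real instances), the strip-isomorphism
  nonemptiness `hNE` (L6-t2 real instances), the pre-(x) observation readings `hwlog`…`hix` (row A-5 — the
  narrative nodes; their honest real readings are not yet typed), the reading wires (`hO…`, `AgreesXIde`),
  and THE GAP implication `hgap` ((xi-f), `p. 184 l. 19–29`).
* `teamA_statement_end_to_end` — the composition with c312-2's real edges through the verbatim volumes:
  granting additionally `BridgeHyps`, `|log(q)| > 0` and the funnel reading of (xi-f)'s conclusion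
  (`hread`), the printed `Statement` follows. This is `teamA_statement_modulo` with the nineteen content
  implications DISCHARGED per node instead of assumed wholesale.

QUANTIFIER CAUTION (skel FORK FINDING 23:23:08Z, A1 ruling 01:40Z): `hread`'s per-packet funnel is the
SUFFICIENT catalogue form, strictly stronger than the printed global conclusion; the GAP-LEDGER row carries
the GLOBAL form (skel XXIV). [claim: Mochizuki2012, status: disputed] Deliberately NOT here: any claim that
`hgap`/`hread` hold for an instantiated setting; the A-5 honest readings (future row); any judgement.
-/

namespace Summit.ABC

namespace IUTFork

namespace Cor312Proof

open Locus Obs Thm311 Cor312 Cor312Vol StepXI Literature.IUT.LogThetaLattice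

variable {T : ThetaIndex} {S : Situation T} {P : Cor312.Setting S}

/-- **TEAM A FULL CHAIN**: all twenty printed nodes hold under `(L, O)` from the named inputs — per-node
provenance in the module docstring; the hypothesis list is the census. [claim: Mochizuki2012, status: disputed] -/
theorem teamA_chain (C : Column S.L) (D : ThetaLinkStrips P.LogLink P.Strip) {L : Locus → Prop}
    {O : Obs → Prop}
    -- pre-(x) observation readings (row A-5, granted):
    (hwlog : O .restrictToStrips) (hi1 : O .linkSplits) (hi2 : O .valueGroupMapsPilots)
    (hii1 : O .unitsSubjectInd12) (hii2 : O .cyclotomesInsulated) (hiii : O .singleLinkNecessary)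
    (hiv : O .singleLinkNecessary → O .verticalShiftSolved)
    (hv : O .linkSplits → O .unitsRelatedContainers ∧ O .frobeniusLikeRelatedToCoric)
    (hvi : O .frobeniusLikeRelatedToCoric →
      O .logKummerViaGaloisEvaluation ∧ O .conjSyncLogLinkCompatible ∧ O .cycRigidityApproaches)
    (hvii : O .cycRigidityApproaches → O .symmetriesSeparate ∧ O .symmetriesMultiradial)
    (hviii : O .symmetriesSeparate → O .conjugacyIndetResolved)
    (hix : O .symmetriesSeparate → O .unitsRelatedContainers → O .fmodTranslation)
    -- Step (x) loci-side real discharges (Team B rows B-2/B-4) and reading wires (A-1):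
    (hIndAdm : ∀ Φ ∈ S.L.Ind1Family ∪ S.L.Ind2Family, ∀ (j : T.Label) (vQ : T.VQ)
      (A : Set (S.L.Packet j vQ)), (S.D P.n).Adm j vQ A ↔ (S.D P.n).Adm j vQ (Φ j vQ '' A))
    (hIndVol : (S.D P.n).LogvolInvariant)
    (hMono : ∀ (j : T.Label) (vQ : T.VQ) (A B : Set (S.L.Packet j vQ)),
      (S.D P.n).Adm j vQ A → (S.D P.n).Adm j vQ B → A ⊆ B →
        (S.D P.n).logvol j vQ A ≤ (S.D P.n).logvol j vQ B)
    (hKumA : C.KummerA (S.D P.n))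
    (hO1 : StepX.KummerDetach P → O .kummerDetachmentInd123)
    (hO2 : StepX.LogvolCoarse P → O .logvolInvariantInequality)
    (hO3 : StepX.LogvolLogLink P C → O .logvolLogLinkCompatible)
    (hO4 : StepX.TensorMultZ P → O .tensorIdentifiesMultZ)
    -- Steps (xi-a)–(xi-c) inputs and wires (A-2):
    {VG CIPL CSHE : Prop} (hVG : O .valueGroupMapsPilots → VG)
    (hNE : ∀ n m : ℤ, Nonempty (P.IsoS (D.stripLGP (P.lattice.logLink n (m - 1)))
      (D.stripDelta (P.lattice.theater (n + 1) m))))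
    (hOxia : LinkAsGluing P D VG → O .linkAsGluing)
    (hIPL : L .IPL → CIPL) (hSHE : L .SHE → CSHE)
    (hOb1 : OutputIPLSHE CIPL CSHE → O .outputSatisfiesIPLSHE)
    (hOb2 : ValueGroupFullPoly P D → O .valueGroupLinkFullPolyIso)
    (hOb3 : OnlyQualitative → O .onlyQualitative)
    (hIPLrev : O .outputSatisfiesIPLSHE → OutputIPLSHE CIPL CSHE)
    (hOc1 : DisplayXIc P D CIPL CSHE → O .displayXIc)
    (hOc2 : HullComparable P → O .hullGivesVectorBundles)
    -- Steps (xi-d)/(xi-e) (A-3) with the Statement's own side conditions: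
    (hXIde : P.AgreesXIde O) (hfin : P.ThetaFinite) (hq : P.AbsLogQPos)
    -- the tail (A-4): THE GAP implication, (xi-g)'s wire, the two terminal observations:
    (hgap : O .displayXIe → O .sheMeansFixedValue → O .constitutesConstruction)
    (htw : O .twoEquivalentWays) (hh : O .noNthPower) (hx : O .globalFrobenioidsNeeded) :
    Chain L O := by
  intro s
  cases s
  case wlog => exact wlog_holds_of hwlog
  case i => exact i_holds_of hi1 hi2
  case ii => exact ii_holds_of hii1 hii2
  case iii => exact iii_holds_of hiii
  case iv => exact iv_holds_of hiv
  case v => exact v_holds_of hv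
  case vi => exact vi_holds_of hvi
  case vii => exact vii_holds_of hvii
  case viii => exact viii_holds_of hviii
  case ix => exact ix_holds_of hix
  case x =>
    exact stepX_holds P C (fun _ _ => hIndAdm) (fun _ _ _ => hIndVol) (fun _ => hMono)
      (fun _ => hKumA) hO1 hO2 hO3 hO4
  case xi_a => exact stepXIa_holds P D hVG hNE hOxia
  case xi_b => exact stepXIb_holds P D hIPL hSHE hOb1 hOb2 hOb3
  case xi_c => exact stepXIc_holds P D hIPLrev hOc1 hOc2
  case xi_d => exact Cor312.Setting.stepXId_holds_of hXIde hfin hq L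
  case xi_e => exact Cor312.Setting.stepXIe_holds hXIde L
  case xi_f => exact xi_f_holds_iff.2 hgap
  case xi_g => exact xi_g_holds_iff.2 fun _ _ => htw
  case xi_h => exact xi_h_holds_of hh
  case xii => exact xii_holds_of hx

/-- **TEAM A END-TO-END**: the full chain composed with the real edges through the verbatim volumes —
granting additionally the bridge hypotheses and the funnel reading of (xi-f)'s conclusion, the printed
`Statement` follows. The inputs that remain undischarged for the assembled real setting are exactly the
census above plus `hread`/`hgap` — the team's GAP. [claim: Mochizuki2012, status: disputed] -/
theorem teamA_statement_end_to_end (H : BridgeHyps P) (C : Column S.L)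
    (D : ThetaLinkStrips P.LogLink P.Strip) {L : Locus → Prop} {O : Obs → Prop} (hL : ∀ c, L c)
    (hwlog : O .restrictToStrips) (hi1 : O .linkSplits) (hi2 : O .valueGroupMapsPilots)
    (hii1 : O .unitsSubjectInd12) (hii2 : O .cyclotomesInsulated) (hiii : O .singleLinkNecessary)
    (hiv : O .singleLinkNecessary → O .verticalShiftSolved)
    (hv : O .linkSplits → O .unitsRelatedContainers ∧ O .frobeniusLikeRelatedToCoric)
    (hvi : O .frobeniusLikeRelatedToCoric →
      O .logKummerViaGaloisEvaluation ∧ O .conjSyncLogLinkCompatible ∧ O .cycRigidityApproaches)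
    (hvii : O .cycRigidityApproaches → O .symmetriesSeparate ∧ O .symmetriesMultiradial)
    (hviii : O .symmetriesSeparate → O .conjugacyIndetResolved)
    (hix : O .symmetriesSeparate → O .unitsRelatedContainers → O .fmodTranslation)
    (hIndAdm : ∀ Φ ∈ S.L.Ind1Family ∪ S.L.Ind2Family, ∀ (j : T.Label) (vQ : T.VQ)
      (A : Set (S.L.Packet j vQ)), (S.D P.n).Adm j vQ A ↔ (S.D P.n).Adm j vQ (Φ j vQ '' A))
    (hIndVol : (S.D P.n).LogvolInvariant)
    (hMono : ∀ (j : T.Label) (vQ : T.VQ) (A B : Set (S.L.Packet j vQ)),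
      (S.D P.n).Adm j vQ A → (S.D P.n).Adm j vQ B → A ⊆ B →
        (S.D P.n).logvol j vQ A ≤ (S.D P.n).logvol j vQ B)
    (hKumA : C.KummerA (S.D P.n))
    (hO1 : StepX.KummerDetach P → O .kummerDetachmentInd123)
    (hO2 : StepX.LogvolCoarse P → O .logvolInvariantInequality)
    (hO3 : StepX.LogvolLogLink P C → O .logvolLogLinkCompatible)
    (hO4 : StepX.TensorMultZ P → O .tensorIdentifiesMultZ)
    {VG CIPL CSHE : Prop} (hVG : O .valueGroupMapsPilots → VG)
    (hNE : ∀ n m : ℤ, Nonempty (P.IsoS (D.stripLGP (P.lattice.logLink n (m - 1)))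
      (D.stripDelta (P.lattice.theater (n + 1) m))))
    (hOxia : LinkAsGluing P D VG → O .linkAsGluing)
    (hIPL : L .IPL → CIPL) (hSHE : L .SHE → CSHE)
    (hOb1 : OutputIPLSHE CIPL CSHE → O .outputSatisfiesIPLSHE)
    (hOb2 : ValueGroupFullPoly P D → O .valueGroupLinkFullPolyIso)
    (hOb3 : OnlyQualitative → O .onlyQualitative)
    (hIPLrev : O .outputSatisfiesIPLSHE → OutputIPLSHE CIPL CSHE)
    (hOc1 : DisplayXIc P D CIPL CSHE → O .displayXIc)
    (hOc2 : HullComparable P → O .hullGivesVectorBundles)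
    (hXIde : P.AgreesXIde O) (hq : P.AbsLogQPos)
    (hgap : O .displayXIe → O .sheMeansFixedValue → O .constitutesConstruction)
    (htw : O .twoEquivalentWays) (hh : O .noNthPower) (hx : O .globalFrobenioidsNeeded)
    (hread : O .constitutesConstruction →
      ∀ (i : Fin T.lstar) (vQ : T.VQ),
        P.qLocal (Setting.labelSucc i) vQ ≤ (P.thetaLocal (Setting.labelSucc i) vQ).untopD 0) :
    P.Statement :=
  (verbatimVolumes_cor312_iff H hq).1
    (cor312_of_chain hL
      (teamA_chain C D hwlog hi1 hi2 hii1 hii2 hiii hiv hv hvi hvii hviii hix hIndAdm hIndVol hMono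
        hKumA hO1 hO2 hO3 hO4 hVG hNE hOxia hIPL hSHE hOb1 hOb2 hOb3 hIPLrev hOc1 hOc2 hXIde
        H.finite hq hgap htw hh hx)
      ((realEdges_verbatim_iff H hq O).2 fun hc => statement_of_qLocal_le H (hread hc)))

end Cor312Proof

end IUTFork

end Summit.ABC
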